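import Summits.QuantumFields.YangMills.Theorems.LuscherReductionTwistedTraceScalingBaseOfWindow
import Summits.QuantumFields.YangMills.Theorems.LuscherReductionTwistedTraceScalingTowerOfUniform
import Summits.QuantumFields.YangMills.Theorems.LuscherReductionTraceDoorCorollary
import HarnessLib

/-!
# Crux RED `RunningReduction` (stmt-QuantumFields-19978), skeleton «KTR» rev 8, KT door: the HAND-OVER SEAM with 3b′ CLOSED —
# `CoarseHandoverUpper 2 ↔ CoarseNoIntruder`, `TwistedTraceScaling → CoarseHandoverUpper 2`, `CoarseHandoverUpper 2 → DressedRitz → RED`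

Route `LuscherReduction` (rung R2b1), crux RED `RunningReduction` (stmt-QuantumFields-19978), registered skeleton «KTR» rev 8
(`pub/ym-beyond/p1-g19-files/Lines-KTR-r8.lean`, sha16 4d4e029b06d8e70b).  Its KT door (PART 1 «KTCoarseHandover» + PART 3) reads: MatchedCoupling L₀ →
3a′ `CoarseHandoverUpper L₀` → 3b′ `CoarseNoIntruderAt L₀` → stub 3 `CoarseNoIntruder` → (+ `DressedRitz`, ONE) → RED, at the canonical coarse size `L₀ = 2`.
With 3b′ a tree theorem (COARSE-UPPER(2): `TwoLattice.Base.coarseUpper_all 2` = `TwoLattice.ConstTube.coarseUpper` at `L = 2`; landed BY NAME for RED as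
`KTCoarseHandover.stub_coarseNoIntruderAt2`, p793706), with COARSE-LOWER(2) a tree theorem as well (`TwoLattice.Base.coarseLower_all 2`), and with the matching of
two-loop labels a tree theorem (`TwoLattice.Tower.exists_matched`, IVT), the seam collapses to statements about 3a′ ALONE.  This module re-homes the
skeleton's seam proofs VERBATIM over tree names (texts spelled out; no definitions) and records the collapse:

* `matchedCoupling (L0)` — text of the skeleton's `MatchedCoupling L0` (every fine window point has a coarse partner `β' ≥ 1` with the same `Λ`), from
  `Tower.exists_matched` + `Tower.one_le_invRunningCoupling_of_window` (`lamM = 1/2`);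
* `coarseNoIntruder_of_handover (L0)` — skeleton PART 1 VERBATIM: `MatchedCoupling L0 → CoarseHandoverUpper L0 → CoarseNoIntruderAt L0 → CoarseNoIntruder`;
* `coarseHandoverUpper_of_coarseNoIntruder (L0)` — skeleton PART 1 VERBATIM (faithfulness): `CoarseNoIntruder → CoarseLowerAt L0 → CoarseHandoverUpper L0`;
* ★ `coarseNoIntruder_of_coarseHandoverUpper_two : ⟨3a′⟩ → ⟨CoarseNoIntruder⟩` and ★ `coarseHandoverUpper_two_of_coarseNoIntruder : ⟨CoarseNoIntruder⟩ → ⟨3a′⟩`,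
  hence ★★ `coarseHandoverUpper_two_iff_coarseNoIntruder` — with 3b′, COARSE-LOWER(2) and the matching discharged, RED's registered stub 3a′
  `stub_coarseHandoverUpper2` IS KT's former global stub 3 (Lüscher's law from below with relative error `o(1)`, lift-free, `L`-uniform);
* ★★ `coarseHandoverUpper_two_of_twistedTraceScaling : TwistedTraceScaling → ⟨3a′⟩` — the sibling crux (stmt-QuantumFields-20203) DOMINATES 3a′
  (tree `TraceDoor.coarseLevels_of_twistedTraceScaling` + `coarseNoIntruder_of_coarseLevels`): a planner-facing DAG fact — closing 20203 closes 3a′ by name;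
* ★★ `runningReduction_of_coarseHandoverUpper_two_dressedRitz : ⟨3a′⟩ → DressedRitz → RunningReduction` — the KT door of RED needs EXACTLY the RG stub 3a′ and
  the child `DressedRitz` (stmt-QuantumFields-20205) (tree `TraceDoor.runningReduction_of_coarseNoIntruder`: Kato–Temple door, Ritz basics, ONE all inside).

The texts `⟨3a′⟩ = CoarseHandoverUpper 2`, `⟨3b′⟩ = CoarseNoIntruderAt L0`, `⟨CoarseNoIntruder⟩`, `⟨CoarseLowerAt L0⟩`, `⟨MatchedCoupling L0⟩` are spelled out
VERBATIM from the skeleton (no `def`s here; this module does not import p793706 — 3b′ is fed as `Base.coarseUpper_all 2`, the same term).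

HONEST FRAMING: pure real bookkeeping (powers, exponentials, one IVT) on the femto rung R2b1 of the CONDITIONAL Lüscher reduction route; 3a′
(`CoarseHandoverUpper 2` = one-sided cutoff universality of the femto spectrum, fine `L → ∞` versus coarse `2`, at matched two-loop label — the RG
statement), `TwistedTraceScaling`, `DressedRitz`, `ExplicitNoIntruder` stay OPEN; nothing here bears on infinite volume, the continuum limit, a mass
gap or Clay.  Sorry-free, no definitions, no named-fact hypotheses.
-/

set_option autoImplicit false

noncomputable section

open MeasureTheory Filter Topology Real

namespace Summit.QuantumFields.YangMills.Theorems.FemtoTransferGap.KTCoarseHandover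

open Summit.QuantumFields.YangMills.Theorems.FemtoTransferGap
open Summit.QuantumFields.YangMills.Theorems.FemtoTransferGap.TwoLattice

/-! ## §1 Matching of two-loop labels (skeleton `MatchedCoupling L0`, proved there by an explicit IVT; here from `Tower.exists_matched`) -/

/-- **`MatchedCoupling L0` (text of skeleton «KTR» r8 PART 1, support S)**: every fine window point `(L, β)` at depth `lam ≤ 1/2` has a coarse
partner `β' ≥ 1` on the lattice `L0` with the same two-loop parameter, `Λ(β', L0) = Λ(β, L)`.  Proof: in the window the label
`1/ḡ²(β, L) ≥ 1` (`Tower.one_le_invRunningCoupling_of_window`), every label value `≥ 1` is attained on `L0` at some `β' ≥ 1`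
(`Tower.exists_matched`, intermediate value theorem), and `Λ` is a function of the label (`Tower.luscherLambda_eq_of_matched`).
[cite: LuscherMunster1984, §2] -/
theorem matchedCoupling (L0 : ℕ) [NeZero L0] :
    ∃ lamM : ℝ, 0 < lamM ∧ ∀ lam : ℝ, 0 < lam → lam ≤ lamM →
      ∀ (L : ℕ) [NeZero L] (β : ℝ), InFemtoWindow lam β L → ∃ β' : ℝ, 1 ≤ β' ∧ luscherLambda β' L0 = luscherLambda β L := by
  refine ⟨1 / 2, by norm_num, ?_⟩
  intro lam hlam hle L _ β hW
  have hv : 1 ≤ invRunningCoupling β L := Tower.one_le_invRunningCoupling_of_window hlam hle hW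
  obtain ⟨β', hβ', hmatch⟩ := Tower.exists_matched L0 hv
  exact ⟨β', hβ', Tower.luscherLambda_eq_of_matched hmatch⟩

/-! ## §2 The seam VERBATIM (skeleton PART 1): 3a′ + 3b′ + matching ⇒ stub 3, and faithfulness -/

/-- `exp(x/n)^n = exp x` for a lattice size `n`. [folklore] -/
private theorem exp_div_pow (x : ℝ) (n : ℕ) [NeZero n] : Real.exp (x / n) ^ n = Real.exp x := by
  have hn : (n : ℝ) ≠ 0 := Nat.cast_ne_zero.mpr (NeZero.ne n)
  rw [← Real.exp_nat_mul]; congr 1; field_simp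

set_option maxHeartbeats 400000 in
/-- **The KT-currency hand-over composition (skeleton «KTR» r8 PART 1 `coarseNoIntruder_of_handover`, VERBATIM over tree names):
`MatchedCoupling L0 → CoarseHandoverUpper L0 → CoarseNoIntruderAt L0 → CoarseNoIntruder`.**  Given `d < Δ_k` put `ε = (Δ_k − d)/2`,
`d' = d + ε < Δ_k`; in the window take the coarse partner `β'` (`λ(β',L0) = λ(β,L) =: l`, so `(L0,β')` is in the window at `L0`); BOTTOM at `d'`
raised to the power `L0` gives `λ'_k^{L0} ≤ e^{−d'l} λ'_0^{L0}`, UV′-upper gives `λ_k^L λ'_0^{L0} ≤ e^{εl} λ'_k^{L0} λ_0^L ≤ e^{−dl} λ'_0^{L0} λ_0^L`;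
cancel `λ'_0^{L0} > 0` and take the `L`-th root. [cite: Luscher1983, §3] [cite: LuscherMunster1984, §2] -/
theorem coarseNoIntruder_of_handover (L0 : ℕ) [NeZero L0]
    (hM : ∃ lamM : ℝ, 0 < lamM ∧ ∀ lam : ℝ, 0 < lam → lam ≤ lamM →
      ∀ (L : ℕ) [NeZero L] (β : ℝ), InFemtoWindow lam β L → ∃ β' : ℝ, 1 ≤ β' ∧ luscherLambda β' L0 = luscherLambda β L)
    (hU : ∀ k : ℕ, ∀ ε : ℝ, 0 < ε → ∃ lam0 : ℝ, 0 < lam0 ∧ ∀ lam : ℝ, 0 < lam → lam ≤ lam0 →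
      ∃ L1 : ℕ, ∀ (L : ℕ) [NeZero L], L1 ≤ L → ∀ β : ℝ, InFemtoWindow lam β L →
        ∀ β' : ℝ, 1 ≤ β' → luscherLambda β' L0 = luscherLambda β L →
          levelValue su2Rep L β k ^ L * levelValue su2Rep L0 β' 0 ^ L0 ≤
            Real.exp (ε * luscherLambda β L) * (levelValue su2Rep L0 β' k ^ L0 * levelValue su2Rep L β 0 ^ L))
    (hB : ∀ k : ℕ, ∀ d : ℝ, d < levelGap k → ∃ lam0 : ℝ, 0 < lam0 ∧ ∀ lam : ℝ, 0 < lam → lam ≤ lam0 →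
      ∀ β : ℝ, InFemtoWindow lam β L0 →
        levelValue su2Rep L0 β k ≤ Real.exp (-(d * luscherLambda β L0) / L0) * levelValue su2Rep L0 β 0) :
    (∀ k : ℕ, ∀ d : ℝ, d < levelGap k → ∃ lam0 : ℝ, 0 < lam0 ∧ ∀ lam : ℝ, 0 < lam → lam ≤ lam0 →
      ∃ L0 : ℕ, ∀ (L : ℕ) [NeZero L], L0 ≤ L → ∀ β : ℝ, InFemtoWindow lam β L →
        levelValue su2Rep L β k ≤ Real.exp (-(d * luscherLambda β L) / L) * levelValue su2Rep L β 0) := by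
  -- adapted from the registered skeleton `Lines-KTR-r8.lean` PART 1 (owner ym-beyond-p1 g16–g19)
  intro k d hd
  obtain ⟨lamM, hlamM, HM⟩ := hM
  set ε : ℝ := (levelGap k - d) / 2 with hε_def
  have hε : 0 < ε := by rw [hε_def]; linarith
  set d' : ℝ := d + ε with hd'_def
  have hd' : d' < levelGap k := by rw [hd'_def, hε_def]; linarith
  obtain ⟨lU, hlU, HU⟩ := hU k ε hε
  obtain ⟨lB, hlB, HB⟩ := hB k d' hd'
  refine ⟨min lamM (min lU lB), lt_min hlamM (lt_min hlU hlB), ?_⟩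
  intro lam hlam hle
  have hleM : lam ≤ lamM := hle.trans (min_le_left _ _)
  have hleU : lam ≤ lU := (hle.trans (min_le_right _ _)).trans (min_le_left _ _)
  have hleB : lam ≤ lB := (hle.trans (min_le_right _ _)).trans (min_le_right _ _)
  obtain ⟨L1, HL⟩ := HU lam hlam hleU
  refine ⟨L1, ?_⟩
  intro L _ hL β hw
  have hβ1 : 1 ≤ β := hw.1
  obtain ⟨β', hβ'1, hmatch⟩ := HM lam hlam hleM L β hw
  have hw' : InFemtoWindow lam β' L0 := by
    refine ⟨hβ'1, ?_, ?_⟩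
    · rw [hmatch]; exact hw.2.1
    · rw [hmatch]; exact hw.2.2
  have hU1 := HL L hL β hw β' hβ'1 hmatch
  have hB1 := HB lam hlam hleB β' hw'
  rw [hmatch] at hB1
  set l : ℝ := luscherLambda β L with hl_def
  set xk := levelValue su2Rep L β k with hxk_def
  set x0 := levelValue su2Rep L β 0 with hx0_def
  set yk := levelValue su2Rep L0 β' k with hyk_def
  set y0 := levelValue su2Rep L0 β' 0 with hy0_def
  have hxk : 0 ≤ xk := transferValuesNonneg L β k hβ1
  have hx0 : 0 < x0 := levelValue_zero_su2Rep_pos L β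
  have hyk : 0 ≤ yk := transferValuesNonneg L0 β' k hβ'1
  have hy0 : 0 < y0 := levelValue_zero_su2Rep_pos L0 β'
  -- BOTTOM to the power L0
  have hBp : yk ^ L0 ≤ Real.exp (-(d' * l)) * y0 ^ L0 := by
    have := pow_le_pow_left₀ hyk hB1 L0
    rwa [mul_pow, exp_div_pow] at this
  have hexp : Real.exp (ε * l) * Real.exp (-(d' * l)) = Real.exp (-(d * l)) := by
    rw [← Real.exp_add]; congr 1; rw [hd'_def]; ring
  have key : xk ^ L * y0 ^ L0 ≤ Real.exp (-(d * l)) * x0 ^ L * y0 ^ L0 := by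
    calc xk ^ L * y0 ^ L0 ≤ Real.exp (ε * l) * (yk ^ L0 * x0 ^ L) := hU1
      _ ≤ Real.exp (ε * l) * ((Real.exp (-(d' * l)) * y0 ^ L0) * x0 ^ L) :=
          mul_le_mul_of_nonneg_left (mul_le_mul_of_nonneg_right hBp (pow_nonneg hx0.le _)) (Real.exp_pos _).le
      _ = (Real.exp (ε * l) * Real.exp (-(d' * l))) * x0 ^ L * y0 ^ L0 := by ring
      _ = Real.exp (-(d * l)) * x0 ^ L * y0 ^ L0 := by rw [hexp]
  have hpos : 0 < y0 ^ L0 := pow_pos hy0 L0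
  have key2 : xk ^ L ≤ Real.exp (-(d * l)) * x0 ^ L := le_of_mul_le_mul_right key hpos
  -- L-th root
  have key3 : xk ^ L ≤ (Real.exp (-(d * l) / L) * x0) ^ L := by rwa [mul_pow, exp_div_pow]
  exact (pow_le_pow_iff_left₀ hxk (mul_nonneg (Real.exp_pos _).le hx0.le) (NeZero.ne L)).mp key3

set_option maxHeartbeats 400000 in
/-- **Faithfulness in KT currency (skeleton «KTR» r8 PART 1 `coarseHandoverUpper_of_coarseNoIntruder`, VERBATIM over tree names):
`CoarseNoIntruder → CoarseLowerAt L0 → CoarseHandoverUpper L0`.**  Fine side at `d = Δ_k − ε/2` to the power `L`, coarse lower bound at `ε/2` to the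
power `L0`, multiply.  So UV′-upper(L0) is EQUIVALENT to KT's global no-intruder stub modulo the fixed-lattice pair {`CoarseNoIntruderAt L0`,
`CoarseLowerAt L0`}. [cite: Luscher1983, §3] [cite: LuscherMunster1984, §2] -/
theorem coarseHandoverUpper_of_coarseNoIntruder (L0 : ℕ) [NeZero L0]
    (hC : ∀ k : ℕ, ∀ d : ℝ, d < levelGap k → ∃ lam0 : ℝ, 0 < lam0 ∧ ∀ lam : ℝ, 0 < lam → lam ≤ lam0 →
      ∃ L0 : ℕ, ∀ (L : ℕ) [NeZero L], L0 ≤ L → ∀ β : ℝ, InFemtoWindow lam β L →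
        levelValue su2Rep L β k ≤ Real.exp (-(d * luscherLambda β L) / L) * levelValue su2Rep L β 0)
    (hLow : ∀ k : ℕ, ∀ ε : ℝ, 0 < ε → ∃ lam0 : ℝ, 0 < lam0 ∧ ∀ lam : ℝ, 0 < lam → lam ≤ lam0 →
      ∀ β : ℝ, InFemtoWindow lam β L0 →
        Real.exp (-((levelGap k + ε) * luscherLambda β L0) / L0) * levelValue su2Rep L0 β 0 ≤ levelValue su2Rep L0 β k) :
    (∀ k : ℕ, ∀ ε : ℝ, 0 < ε → ∃ lam0 : ℝ, 0 < lam0 ∧ ∀ lam : ℝ, 0 < lam → lam ≤ lam0 →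
      ∃ L1 : ℕ, ∀ (L : ℕ) [NeZero L], L1 ≤ L → ∀ β : ℝ, InFemtoWindow lam β L →
        ∀ β' : ℝ, 1 ≤ β' → luscherLambda β' L0 = luscherLambda β L →
          levelValue su2Rep L β k ^ L * levelValue su2Rep L0 β' 0 ^ L0 ≤
            Real.exp (ε * luscherLambda β L) * (levelValue su2Rep L0 β' k ^ L0 * levelValue su2Rep L β 0 ^ L)) := by
  -- adapted from the registered skeleton `Lines-KTR-r8.lean` PART 1 (owner ym-beyond-p1 g16–g19)
  intro k ε hε
  obtain ⟨lC, hlC, HC⟩ := hC k (levelGap k - ε / 2) (by linarith)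
  obtain ⟨lW, hlW, HW⟩ := hLow k (ε / 2) (by linarith)
  refine ⟨min lC lW, lt_min hlC hlW, ?_⟩
  intro lam hlam hle
  obtain ⟨L1, HL⟩ := HC lam hlam (hle.trans (min_le_left _ _))
  refine ⟨L1, ?_⟩
  intro L _ hL β hw β' hβ'1 hmatch
  have hβ1 : 1 ≤ β := hw.1
  have hw' : InFemtoWindow lam β' L0 := by
    refine ⟨hβ'1, ?_, ?_⟩
    · rw [hmatch]; exact hw.2.1
    · rw [hmatch]; exact hw.2.2
  have hC1 := HL L hL β hw
  have hW1 := HW lam hlam (hle.trans (min_le_right _ _)) β' hw'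
  rw [hmatch] at hW1
  set l : ℝ := luscherLambda β L with hl_def
  set xk := levelValue su2Rep L β k with hxk_def
  set x0 := levelValue su2Rep L β 0 with hx0_def
  set yk := levelValue su2Rep L0 β' k with hyk_def
  set y0 := levelValue su2Rep L0 β' 0 with hy0_def
  have hxk : 0 ≤ xk := transferValuesNonneg L β k hβ1
  have hx0 : 0 < x0 := levelValue_zero_su2Rep_pos L β
  have hy0 : 0 < y0 := levelValue_zero_su2Rep_pos L0 β'
  have hCp : xk ^ L ≤ Real.exp (-((levelGap k - ε / 2) * l)) * x0 ^ L := by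
    have := pow_le_pow_left₀ hxk hC1 L
    rwa [mul_pow, exp_div_pow] at this
  have hWp : Real.exp (-((levelGap k + ε / 2) * l)) * y0 ^ L0 ≤ yk ^ L0 := by
    have := pow_le_pow_left₀ (mul_nonneg (Real.exp_pos _).le hy0.le) hW1 L0
    rwa [mul_pow, exp_div_pow] at this
  have hexp : Real.exp (-((levelGap k - ε / 2) * l)) = Real.exp (ε * l) * Real.exp (-((levelGap k + ε / 2) * l)) := by
    rw [← Real.exp_add]; congr 1; ring
  calc xk ^ L * y0 ^ L0 ≤ (Real.exp (-((levelGap k - ε / 2) * l)) * x0 ^ L) * y0 ^ L0 :=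
        mul_le_mul_of_nonneg_right hCp (pow_nonneg hy0.le _)
    _ = Real.exp (ε * l) * ((Real.exp (-((levelGap k + ε / 2) * l)) * y0 ^ L0) * x0 ^ L) := by rw [hexp]; ring
    _ ≤ Real.exp (ε * l) * (yk ^ L0 * x0 ^ L) :=
        mul_le_mul_of_nonneg_left (mul_le_mul_of_nonneg_right hWp (pow_nonneg hx0.le _)) (Real.exp_pos _).le

/-! ## §3 ★ The collapse at the canonical coarse size `L₀ = 2` (3b′ ✓ p793706, COARSE-LOWER(2) ✓, matching ✓) -/

/-- ★ **Stub 3 from 3a′ ALONE: `CoarseHandoverUpper 2 → CoarseNoIntruder`** (skeleton `coarseNoIntruder_of_handover_two` with BOTH remaining inputs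
discharged: matching `matchedCoupling 2`, BOTTOM-upper 3b′ = `Base.coarseUpper_all 2` (= `stub_coarseNoIntruderAt2`, p793706)). [cite: Luscher1983, §3]
[cite: LuscherMunster1984, §2] -/
theorem coarseNoIntruder_of_coarseHandoverUpper_two
    (hU : ∀ k : ℕ, ∀ ε : ℝ, 0 < ε → ∃ lam0 : ℝ, 0 < lam0 ∧ ∀ lam : ℝ, 0 < lam → lam ≤ lam0 →
      ∃ L1 : ℕ, ∀ (L : ℕ) [NeZero L], L1 ≤ L → ∀ β : ℝ, InFemtoWindow lam β L →
        ∀ β' : ℝ, 1 ≤ β' → luscherLambda β' 2 = luscherLambda β L →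
          levelValue su2Rep L β k ^ L * levelValue su2Rep 2 β' 0 ^ 2 ≤
            Real.exp (ε * luscherLambda β L) * (levelValue su2Rep 2 β' k ^ 2 * levelValue su2Rep L β 0 ^ L)) :
    (∀ k : ℕ, ∀ d : ℝ, d < levelGap k → ∃ lam0 : ℝ, 0 < lam0 ∧ ∀ lam : ℝ, 0 < lam → lam ≤ lam0 →
      ∃ L0 : ℕ, ∀ (L : ℕ) [NeZero L], L0 ≤ L → ∀ β : ℝ, InFemtoWindow lam β L →
        levelValue su2Rep L β k ≤ Real.exp (-(d * luscherLambda β L) / L) * levelValue su2Rep L β 0) :=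
  coarseNoIntruder_of_handover 2 (matchedCoupling 2) hU (Base.coarseUpper_all 2)

/-- ★ **3a′ from stub 3: `CoarseNoIntruder → CoarseHandoverUpper 2`** (faithfulness with COARSE-LOWER(2) discharged by the tree theorem
`TwoLattice.Base.coarseLower_all 2`). [cite: Luscher1983, §3] [cite: LuscherMunster1984, §2] -/
theorem coarseHandoverUpper_two_of_coarseNoIntruder
    (hC : ∀ k : ℕ, ∀ d : ℝ, d < levelGap k → ∃ lam0 : ℝ, 0 < lam0 ∧ ∀ lam : ℝ, 0 < lam → lam ≤ lam0 →
      ∃ L0 : ℕ, ∀ (L : ℕ) [NeZero L], L0 ≤ L → ∀ β : ℝ, InFemtoWindow lam β L →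
        levelValue su2Rep L β k ≤ Real.exp (-(d * luscherLambda β L) / L) * levelValue su2Rep L β 0) :
    (∀ k : ℕ, ∀ ε : ℝ, 0 < ε → ∃ lam0 : ℝ, 0 < lam0 ∧ ∀ lam : ℝ, 0 < lam → lam ≤ lam0 →
      ∃ L1 : ℕ, ∀ (L : ℕ) [NeZero L], L1 ≤ L → ∀ β : ℝ, InFemtoWindow lam β L →
        ∀ β' : ℝ, 1 ≤ β' → luscherLambda β' 2 = luscherLambda β L →
          levelValue su2Rep L β k ^ L * levelValue su2Rep 2 β' 0 ^ 2 ≤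
            Real.exp (ε * luscherLambda β L) * (levelValue su2Rep 2 β' k ^ 2 * levelValue su2Rep L β 0 ^ L)) :=
  coarseHandoverUpper_of_coarseNoIntruder 2 hC (Base.coarseLower_all 2)

/-- ★★ **RED's registered stub 3a′ `stub_coarseHandoverUpper2` IS KT's former global stub 3 `CoarseNoIntruder`** (3b′, COARSE-LOWER(2) and the
matching all discharged): `CoarseHandoverUpper 2 ↔ CoarseNoIntruder`. [cite: Luscher1983, §3] [cite: LuscherMunster1984, §2] -/
theorem coarseHandoverUpper_two_iff_coarseNoIntruder :
    (∀ k : ℕ, ∀ ε : ℝ, 0 < ε → ∃ lam0 : ℝ, 0 < lam0 ∧ ∀ lam : ℝ, 0 < lam → lam ≤ lam0 →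
      ∃ L1 : ℕ, ∀ (L : ℕ) [NeZero L], L1 ≤ L → ∀ β : ℝ, InFemtoWindow lam β L →
        ∀ β' : ℝ, 1 ≤ β' → luscherLambda β' 2 = luscherLambda β L →
          levelValue su2Rep L β k ^ L * levelValue su2Rep 2 β' 0 ^ 2 ≤
            Real.exp (ε * luscherLambda β L) * (levelValue su2Rep 2 β' k ^ 2 * levelValue su2Rep L β 0 ^ L)) ↔
    (∀ k : ℕ, ∀ d : ℝ, d < levelGap k → ∃ lam0 : ℝ, 0 < lam0 ∧ ∀ lam : ℝ, 0 < lam → lam ≤ lam0 →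
      ∃ L0 : ℕ, ∀ (L : ℕ) [NeZero L], L0 ≤ L → ∀ β : ℝ, InFemtoWindow lam β L →
        levelValue su2Rep L β k ≤ Real.exp (-(d * luscherLambda β L) / L) * levelValue su2Rep L β 0) :=
  ⟨coarseNoIntruder_of_coarseHandoverUpper_two, coarseHandoverUpper_two_of_coarseNoIntruder⟩

/-- ★★ **The sibling crux DOMINATES 3a′: `TwistedTraceScaling → CoarseHandoverUpper 2`** (tree `TraceDoor.coarseLevels_of_twistedTraceScaling` —
`TraceFormula`, `OneSiteTail` closed — then `coarseNoIntruder_of_coarseLevels`, then faithfulness at `L₀ = 2`).  Planner-facing DAG fact: closing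
stmt-QuantumFields-20203 closes RED's registered stub 3a′ by name. [cite: Luscher1983, §3] [cite: Feller1971, XIII.1 Thm 2a] -/
theorem coarseHandoverUpper_two_of_twistedTraceScaling
    (hTS : Summit.QuantumFields.YangMills.Theses.LuscherReduction.TwistedTraceScaling) :
    (∀ k : ℕ, ∀ ε : ℝ, 0 < ε → ∃ lam0 : ℝ, 0 < lam0 ∧ ∀ lam : ℝ, 0 < lam → lam ≤ lam0 →
      ∃ L1 : ℕ, ∀ (L : ℕ) [NeZero L], L1 ≤ L → ∀ β : ℝ, InFemtoWindow lam β L →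
        ∀ β' : ℝ, 1 ≤ β' → luscherLambda β' 2 = luscherLambda β L →
          levelValue su2Rep L β k ^ L * levelValue su2Rep 2 β' 0 ^ 2 ≤
            Real.exp (ε * luscherLambda β L) * (levelValue su2Rep 2 β' k ^ 2 * levelValue su2Rep L β 0 ^ L)) :=
  coarseHandoverUpper_two_of_coarseNoIntruder
    (TraceDoor.coarseNoIntruder_of_coarseLevels (TraceDoor.coarseLevels_of_twistedTraceScaling hTS))

/-- ★★ **The KT door of RED with everything but the RG discharged: `CoarseHandoverUpper 2 → DressedRitz → RunningReduction` BY NAME** (3a′ ⇒ stub 3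
by `coarseNoIntruder_of_coarseHandoverUpper_two`; stub 3 + the child `DressedRitz` (stmt-QuantumFields-20205) ⇒ RED by the tree's KT composition
`TraceDoor.runningReduction_of_coarseNoIntruder` — Kato–Temple door, Rayleigh–Ritz ≤ min–max, the coarse one-site lower law from the closed crux ONE,
the enclosure algebra).  So RED's skeleton «KTR» r8 closes from its two remaining XL inputs 3a′ and `stub_dressedRitz` alone.
[cite: Kato1949, Lemma 2, Thm 1] [cite: Luscher1983, §3] [cite: LuscherMunster1984, §2] -/
theorem runningReduction_of_coarseHandoverUpper_two_dressedRitz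
    (hU : ∀ k : ℕ, ∀ ε : ℝ, 0 < ε → ∃ lam0 : ℝ, 0 < lam0 ∧ ∀ lam : ℝ, 0 < lam → lam ≤ lam0 →
      ∃ L1 : ℕ, ∀ (L : ℕ) [NeZero L], L1 ≤ L → ∀ β : ℝ, InFemtoWindow lam β L →
        ∀ β' : ℝ, 1 ≤ β' → luscherLambda β' 2 = luscherLambda β L →
          levelValue su2Rep L β k ^ L * levelValue su2Rep 2 β' 0 ^ 2 ≤
            Real.exp (ε * luscherLambda β L) * (levelValue su2Rep 2 β' k ^ 2 * levelValue su2Rep L β 0 ^ L))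
    (hDR : Summit.QuantumFields.YangMills.Theses.LuscherReduction.DressedRitz) :
    Summit.QuantumFields.YangMills.Theses.LuscherReduction.RunningReduction :=
  TraceDoor.runningReduction_of_coarseNoIntruder (coarseNoIntruder_of_coarseHandoverUpper_two hU) hDR

end Summit.QuantumFields.YangMills.Theorems.FemtoTransferGap.KTCoarseHandover

end
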